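import Summits.NavierStokesRegularity.NavierStokesRegularity.Theses.AxisymmetricExtremality
import Summits.NavierStokesRegularity.NavierStokesRegularity.Theorems.AxisymmetricExtremalityMinimalDatumPFoldConcentrationNearMinimalLimit
import Summits.NavierStokesRegularity.NavierStokesRegularity.Theorems.AxisymmetricExtremalityMinimalDatumPFoldConcentrationWeakLimitBlowup
import Summits.NavierStokesRegularity.NavierStokesRegularity.Theorems.AxisymmetricExtremalityMinimalDatumPFoldUniformRegularity

/-!
# `MinimalDatumPFold` (crux stmt-NavierStokesRegularity-15452), line `Sketch` — TIGHTNESS of the open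
# residual `stub_axisymConcentrationBranch`: parabolic concentration costs at least the threshold
# (cdisprove seat, `Negative/` lane)

The live line `Sketch` (lead c2, `Cruxes/MinimalDatumPFold/Lines/Sketch.lean`) reduces the crux to ONE
open stub, `stub_axisymConcentrationBranch`: under Clay failure at `ν`, a sequence of exactly
axisymmetric SUB-threshold admissible data `U k` (`‖G k‖ₑ < ρ_max^pure(ν)`) whose Kato-class mild
solutions on `[0,1)` CONCENTRATE at `(1, x k)` (the essential suprema of `|u k|` on every backward
cylinder `Q_r(1, x k)` tend to `∞`). This file records how tight that residual is, using only the
line's own LANDED stubs (`stub_uniformRegularity` p157006, `stub_concentrationWeakLimitBlowup` p157748)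
and the Rusin–Šverák weak-compactness toolkit already used by `stub_concentrationNearMinimalLimit`
(p158054):

* `threshold_le_of_concentration` — **concentration costs the threshold**: if admissible data with
  `‖G k‖ ≤ R` have mild solutions on `[0,1)` concentrating at `(1, x k)`, then `ρ_max^pure(ν) ≤ R`
  (no symmetry, no sub-threshold hypothesis, no finiteness of the threshold needed). Proof: the
  concentration weak-limit blow-up statement modulates the data; a weak `Ḣ^{1/2}` limit of the
  modulated classes represents a datum WITHOUT a global Kato solution, whose norm is `≥ ρ_max^pure`
  by the definition of the threshold and `≤ R` by weak lower semicontinuity.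
* `no_concentration_uniformly_below_threshold` — the NEGATIVE LEMMA: with a uniform sub-threshold
  bound `‖G k‖ₑ ≤ ρ' < ρ_max^pure(ν)` the conclusion of `stub_axisymConcentrationBranch` is FALSE
  (its concentration clause fails). So the clause "`‖G k‖ₑ < ρ_max^pure(ν)` for each `k`" cannot be
  strengthened to a uniform gap: any witness sequence must SATURATE the threshold —
* `frequently_threshold_approached_of_concentration` — for every `ρ' < ρ_max^pure(ν)`, frequently
  `ρ' < ‖G k‖ₑ` (i.e. `limsup ‖G k‖ₑ = ρ_max^pure(ν)` for sub-threshold witnesses).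

In particular at a Kato-regular viscosity (`ρ_max^pure = ⊤`) bounded sequences never concentrate
(Disproof.lean §2 (H1) for this line). Statements written out (no new definitions or notations).

## References

* W. Rusin, V. Šverák, J. Funct. Anal. 260 (2011) 879–891 = arXiv:0911.0500, Lemma 2.1, Cor. 4.2–4.3. [RusinSverak2011]
-/

set_option linter.dupNamespace false

noncomputable section

open MeasureTheory Set Function Filter Topology
open scoped ENNReal NNReal
open Literature.Analysis.FluidPDE Literature.Analysis.FunctionSpaces

namespace Summit.NavierStokesRegularity.NavierStokesRegularity.Theorems.MinimalDatumPFold.Negative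

/-- **Concentration costs the threshold (relative form).** GIVEN the concentration weak-limit
blow-up statement (first hypothesis, verbatim the conclusion shape of the landed stub
`stub_concentrationWeakLimitBlowup`): for `ν > 0`, admissible data `(U k, G k)` with `‖G k‖ ≤ R`
whose Kato-class mild solutions `u k` on `[0, 1)` concentrate at `(1, x k)` force
`ρ_max^pure(ν) ≤ R`. Proof: modulate (hypothesis), represent the modulated data by classes of the
same norms (`exists_represents_rescaleData_norm_eq`), extract a weakly convergent subsequence
(`exists_strictMono_tendsto_inner`), whose limit represents a datum without a global Kato solution
(hypothesis), hence of norm `≥ ρ_max^pure(ν)` (`hasGlobalKatoSolution_of_lt_rusinSverakRhoMaxPure`)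
and `≤ R` (`norm_le_of_tendsto_inner_of_norm_le`). [cite: RusinSverak2011, Cor. 4.2 and proof of
Cor. 4.3 (arXiv:0911.0500 p. 8)] -/
theorem threshold_le_of_concentration_of_weakLimitBlowup
    (hWL : ∀ ν : ℝ, 0 < ν → ∀ (U : ℕ → EuclideanSpace ℝ (Fin 3) → EuclideanSpace ℝ (Fin 3)) (G : ℕ →
      Literature.Analysis.FunctionSpaces.HomSobolev (EuclideanSpace ℝ (Fin 3)) (EuclideanSpace ℂ (Fin 3)) (1 / 2 : ℝ)) (u : ℕ
      → ℝ → EuclideanSpace ℝ (Fin 3) → EuclideanSpace ℝ (Fin 3)) (x : ℕ → EuclideanSpace ℝ (Fin 3)), (∀ k,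
      MeasureTheory.MemLp (U k) 3 (MeasureTheory.volume : MeasureTheory.Measure (EuclideanSpace ℝ (Fin 3)))
      ∧ (G k).Represents (Literature.Analysis.FunctionSpaces.EuclideanSpace.complexify ∘ U k) ∧
      Literature.Analysis.FluidPDE.IsWeaklyDivFree (U k)) → (∃ R : ℝ, ∀ k, ‖G k‖ ≤ R) → (∀ k,
      Literature.Analysis.FluidPDE.IsMildNSSolutionOn (Set.Ico 0 1) ν 0 (U k) (u k) ∧
      Literature.Analysis.FluidPDE.ContinuousInLpOn (Set.Ico 0 1) 3 (u k) ∧ u k 0 = U k ∧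
      MeasureTheory.AEStronglyMeasurable (Function.uncurry (u k)) (MeasureTheory.volume.restrict (Set.Ioo (0 : ℝ) 1 ×ˢ (Set.univ : Set (EuclideanSpace ℝ (Fin 3))))))
      → (∀ r : ℝ, 0 < r →
      Filter.Tendsto (fun k => MeasureTheory.eLpNorm (Function.uncurry (u k)) ⊤ (MeasureTheory.volume.restrict (Literature.Analysis.FluidPDE.parabolicCylinder r ((1 : ℝ)
      , x k)))) Filter.atTop (nhds ⊤)) → ∃ (lam : ℕ → ℝ) (x₀ : ℕ → EuclideanSpace ℝ (Fin 3)), (∀ k,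
      0 < lam k) ∧ ∀ g' : ℕ →
      Literature.Analysis.FunctionSpaces.HomSobolev (EuclideanSpace ℝ (Fin 3)) (EuclideanSpace ℂ (Fin 3)) (1 / 2 : ℝ)
      , (∀ k,
      (g' k).Represents (Literature.Analysis.FunctionSpaces.EuclideanSpace.complexify ∘ Literature.Analysis.FluidPDE.rescaleData (lam k) (fun y => U k (y - x₀ k))))
      → ∀ φ : ℕ → ℕ, StrictMono φ →
      ∀ glim : Literature.Analysis.FunctionSpaces.HomSobolev (EuclideanSpace ℝ (Fin 3)) (EuclideanSpace ℂ (Fin 3)) (1 / 2 : ℝ)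
      , (∀ w, Filter.Tendsto (fun n => inner ℂ (g' (φ n)) w) Filter.atTop (nhds (inner ℂ glim w))) →
      ∃ v₀ : EuclideanSpace ℝ (Fin 3) → EuclideanSpace ℝ (Fin 3),
      MeasureTheory.MemLp v₀ 3 (MeasureTheory.volume : MeasureTheory.Measure (EuclideanSpace ℝ (Fin 3))) ∧
      glim.Represents (Literature.Analysis.FunctionSpaces.EuclideanSpace.complexify ∘ v₀) ∧
      Literature.Analysis.FluidPDE.IsWeaklyDivFree v₀ ∧
      ¬ Literature.Analysis.FluidPDE.HasGlobalKatoSolution ν v₀) :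
    ∀ ν : ℝ, 0 < ν → ∀ (U : ℕ → EuclideanSpace ℝ (Fin 3) → EuclideanSpace ℝ (Fin 3)) (G : ℕ →
      Literature.Analysis.FunctionSpaces.HomSobolev (EuclideanSpace ℝ (Fin 3)) (EuclideanSpace ℂ (Fin 3)) (1 / 2 : ℝ)) (u : ℕ
      → ℝ → EuclideanSpace ℝ (Fin 3) → EuclideanSpace ℝ (Fin 3)) (x : ℕ → EuclideanSpace ℝ (Fin 3)),
      (∀ k, MeasureTheory.MemLp (U k) 3 (MeasureTheory.volume : MeasureTheory.Measure (EuclideanSpace ℝ (Fin 3))) ∧ (G k).Represents (Literature.Analysis.FunctionSpaces.EuclideanSpace.complexify ∘ U k) ∧ Literature.Analysis.FluidPDE.IsWeaklyDivFree (U k)) →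
      ∀ R : ℝ, (∀ k, ‖G k‖ ≤ R) →
      (∀ k, Literature.Analysis.FluidPDE.IsMildNSSolutionOn (Set.Ico 0 1) ν 0 (U k) (u k) ∧
      Literature.Analysis.FluidPDE.ContinuousInLpOn (Set.Ico 0 1) 3 (u k) ∧ u k 0 = U k ∧
      MeasureTheory.AEStronglyMeasurable (Function.uncurry (u k)) (MeasureTheory.volume.restrict (Set.Ioo (0 : ℝ) 1 ×ˢ (Set.univ : Set (EuclideanSpace ℝ (Fin 3)))))) →
      (∀ r : ℝ, 0 < r → Filter.Tendsto (fun k => MeasureTheory.eLpNorm (Function.uncurry (u k)) ⊤ (MeasureTheory.volume.restrict (Literature.Analysis.FluidPDE.parabolicCylinder r ((1 : ℝ), x k)))) Filter.atTop (nhds ⊤)) →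
      Literature.Analysis.FluidPDE.rusinSverakRhoMaxPure ν ≤ ENNReal.ofReal R := by
  intro ν hν U G u x hU R hR hkato hconc
  -- (1) modulation by the concentration weak-limit blow-up hypothesis
  obtain ⟨lam, x₀, hlam, hlim⟩ := hWL ν hν U G u x hU ⟨R, hR⟩ hkato hconc
  -- (2) classes of the modulated data, of the same norms
  choose g' hg'rep hg'norm using fun k =>
    Literature.Analysis.FluidPDE.exists_represents_rescaleData_norm_eq (U k) (G k) (hlam k) (x₀ k)
      (hU k).2.1
  -- (3) a weakly convergent subsequence
  haveI : SecondCountableTopology (Literature.Analysis.FunctionSpaces.HomSobolev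
      (EuclideanSpace ℝ (Fin 3)) (EuclideanSpace ℂ (Fin 3)) (1 / 2 : ℝ)) :=
    Literature.Analysis.FluidPDE.homSobolev_half_secondCountableTopology
  obtain ⟨glim, φ, hφ, -, hweak⟩ :=
    Literature.Analysis.FluidPDE.exists_strictMono_tendsto_inner g' (R := R)
      fun n => by rw [hg'norm]; exact hR n
  -- (4) the weak limit represents a blow-up datum: its norm is at least the threshold …
  obtain ⟨v₀, hv3, hvrep, hvdiv, hvblow⟩ := hlim g' hg'rep φ hφ glim hweak
  have hge : Literature.Analysis.FluidPDE.rusinSverakRhoMaxPure ν ≤ ‖glim‖ₑ := by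
    by_contra h
    push Not at h
    exact hvblow
      (Literature.Analysis.FluidPDE.hasGlobalKatoSolution_of_lt_rusinSverakRhoMaxPure hv3 hvrep
        hvdiv h)
  -- (5) … and at most `R` by weak lower semicontinuity
  have hle : ‖glim‖ ≤ R :=
    Literature.Analysis.FluidPDE.norm_le_of_tendsto_inner_of_norm_le hweak tendsto_const_nhds
      (fun n => by rw [hg'norm]; exact hR (φ n))
  calc Literature.Analysis.FluidPDE.rusinSverakRhoMaxPure ν ≤ ‖glim‖ₑ := hge
    _ = ENNReal.ofReal ‖glim‖ := (ofReal_norm glim).symm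
    _ ≤ ENNReal.ofReal R := ENNReal.ofReal_le_ofReal hle

/-- **Concentration costs the threshold (absolute form, over the tree).** The first hypothesis of
`threshold_le_of_concentration_of_weakLimitBlowup` is discharged by the line's LANDED stubs
`stub_concentrationWeakLimitBlowup stub_uniformRegularity` (p157748, p157006): admissible data with
`‖G k‖ ≤ R` whose mild solutions on `[0,1)` concentrate at `(1, x k)` force `ρ_max^pure(ν) ≤ R`.
[cite: RusinSverak2011, Lemma 2.1, Cor. 4.2 (arXiv:0911.0500 pp. 4–8)] -/
theorem threshold_le_of_concentration :
    ∀ ν : ℝ, 0 < ν → ∀ (U : ℕ → EuclideanSpace ℝ (Fin 3) → EuclideanSpace ℝ (Fin 3)) (G : ℕ →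
      Literature.Analysis.FunctionSpaces.HomSobolev (EuclideanSpace ℝ (Fin 3)) (EuclideanSpace ℂ (Fin 3)) (1 / 2 : ℝ)) (u : ℕ
      → ℝ → EuclideanSpace ℝ (Fin 3) → EuclideanSpace ℝ (Fin 3)) (x : ℕ → EuclideanSpace ℝ (Fin 3)),
      (∀ k, MeasureTheory.MemLp (U k) 3 (MeasureTheory.volume : MeasureTheory.Measure (EuclideanSpace ℝ (Fin 3))) ∧ (G k).Represents (Literature.Analysis.FunctionSpaces.EuclideanSpace.complexify ∘ U k) ∧ Literature.Analysis.FluidPDE.IsWeaklyDivFree (U k)) →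
      ∀ R : ℝ, (∀ k, ‖G k‖ ≤ R) →
      (∀ k, Literature.Analysis.FluidPDE.IsMildNSSolutionOn (Set.Ico 0 1) ν 0 (U k) (u k) ∧
      Literature.Analysis.FluidPDE.ContinuousInLpOn (Set.Ico 0 1) 3 (u k) ∧ u k 0 = U k ∧
      MeasureTheory.AEStronglyMeasurable (Function.uncurry (u k)) (MeasureTheory.volume.restrict (Set.Ioo (0 : ℝ) 1 ×ˢ (Set.univ : Set (EuclideanSpace ℝ (Fin 3)))))) →
      (∀ r : ℝ, 0 < r → Filter.Tendsto (fun k => MeasureTheory.eLpNorm (Function.uncurry (u k)) ⊤ (MeasureTheory.volume.restrict (Literature.Analysis.FluidPDE.parabolicCylinder r ((1 : ℝ), x k)))) Filter.atTop (nhds ⊤)) →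
      Literature.Analysis.FluidPDE.rusinSverakRhoMaxPure ν ≤ ENNReal.ofReal R :=
  threshold_le_of_concentration_of_weakLimitBlowup
    (Summit.NavierStokesRegularity.NavierStokesRegularity.Theorems.stub_concentrationWeakLimitBlowup
      Summit.NavierStokesRegularity.NavierStokesRegularity.Theorems.stub_uniformRegularity)

/-- **NEGATIVE LEMMA — `stub_axisymConcentrationBranch` is false with a UNIFORM sub-threshold bound.**
If the data of a candidate witness sequence satisfy `‖G k‖ₑ ≤ ρ'` for all `k` with one
`ρ' < ρ_max^pure(ν)`, then their mild solutions on `[0,1)` do NOT concentrate at any points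
`(1, x k)`. Hence the stub's clause `‖G k‖ₑ < ρ_max^pure(ν)` (each `k`) cannot be strengthened to a
uniform gap, and any genuine witness must saturate the threshold (next theorem). No symmetry is used:
the obstruction is blind to the axisymmetric class. [cite: RusinSverak2011, Lemma 2.1, Cor. 4.2
(arXiv:0911.0500 pp. 4–8)] -/
theorem no_concentration_uniformly_below_threshold :
    ∀ ν : ℝ, 0 < ν → ∀ (U : ℕ → EuclideanSpace ℝ (Fin 3) → EuclideanSpace ℝ (Fin 3)) (G : ℕ →
      Literature.Analysis.FunctionSpaces.HomSobolev (EuclideanSpace ℝ (Fin 3)) (EuclideanSpace ℂ (Fin 3)) (1 / 2 : ℝ)) (u : ℕ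
      → ℝ → EuclideanSpace ℝ (Fin 3) → EuclideanSpace ℝ (Fin 3)) (x : ℕ → EuclideanSpace ℝ (Fin 3)),
      (∀ k, MeasureTheory.MemLp (U k) 3 (MeasureTheory.volume : MeasureTheory.Measure (EuclideanSpace ℝ (Fin 3))) ∧ (G k).Represents (Literature.Analysis.FunctionSpaces.EuclideanSpace.complexify ∘ U k) ∧ Literature.Analysis.FluidPDE.IsWeaklyDivFree (U k)) →
      (∃ ρ' : ℝ≥0∞, ρ' < Literature.Analysis.FluidPDE.rusinSverakRhoMaxPure ν ∧ ∀ k, ‖G k‖ₑ ≤ ρ') →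
      (∀ k, Literature.Analysis.FluidPDE.IsMildNSSolutionOn (Set.Ico 0 1) ν 0 (U k) (u k) ∧
      Literature.Analysis.FluidPDE.ContinuousInLpOn (Set.Ico 0 1) 3 (u k) ∧ u k 0 = U k ∧
      MeasureTheory.AEStronglyMeasurable (Function.uncurry (u k)) (MeasureTheory.volume.restrict (Set.Ioo (0 : ℝ) 1 ×ˢ (Set.univ : Set (EuclideanSpace ℝ (Fin 3)))))) →
      ¬ (∀ r : ℝ, 0 < r → Filter.Tendsto (fun k => MeasureTheory.eLpNorm (Function.uncurry (u k)) ⊤ (MeasureTheory.volume.restrict (Literature.Analysis.FluidPDE.parabolicCylinder r ((1 : ℝ), x k)))) Filter.atTop (nhds ⊤)) := by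
  intro ν hν U G u x hU hbd hkato hconc
  obtain ⟨ρ', hρ', hle⟩ := hbd
  have hρ'top : ρ' ≠ ⊤ := ne_top_of_lt hρ'
  have hR : ∀ k, ‖G k‖ ≤ ρ'.toReal := fun k => by
    have h := ENNReal.toReal_mono hρ'top (hle k)
    rwa [toReal_enorm] at h
  have h := threshold_le_of_concentration ν hν U G u x hU ρ'.toReal hR hkato hconc
  rw [ENNReal.ofReal_toReal hρ'top] at h
  exact absurd hρ' (not_lt.2 h)

/-- **TIGHTNESS — a concentrating sequence saturates the threshold.** If admissible data have mild
solutions on `[0,1)` concentrating at `(1, x k)`, then for every `ρ' < ρ_max^pure(ν)` one has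
`ρ' < ‖G k‖ₑ` for infinitely many `k` (apply the previous theorem to tails). For the witnesses of
`stub_axisymConcentrationBranch` (all norms `< ρ_max^pure(ν)`) this says `limsup ‖G k‖ₑ = ρ_max^pure(ν)`:
the sub-threshold branch must reach the threshold exactly. [cite: RusinSverak2011, Cor. 4.2
(arXiv:0911.0500 p. 8)] -/
theorem frequently_threshold_approached_of_concentration :
    ∀ ν : ℝ, 0 < ν → ∀ (U : ℕ → EuclideanSpace ℝ (Fin 3) → EuclideanSpace ℝ (Fin 3)) (G : ℕ →
      Literature.Analysis.FunctionSpaces.HomSobolev (EuclideanSpace ℝ (Fin 3)) (EuclideanSpace ℂ (Fin 3)) (1 / 2 : ℝ)) (u : ℕ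
      → ℝ → EuclideanSpace ℝ (Fin 3) → EuclideanSpace ℝ (Fin 3)) (x : ℕ → EuclideanSpace ℝ (Fin 3)),
      (∀ k, MeasureTheory.MemLp (U k) 3 (MeasureTheory.volume : MeasureTheory.Measure (EuclideanSpace ℝ (Fin 3))) ∧ (G k).Represents (Literature.Analysis.FunctionSpaces.EuclideanSpace.complexify ∘ U k) ∧ Literature.Analysis.FluidPDE.IsWeaklyDivFree (U k)) →
      (∀ k, Literature.Analysis.FluidPDE.IsMildNSSolutionOn (Set.Ico 0 1) ν 0 (U k) (u k) ∧
      Literature.Analysis.FluidPDE.ContinuousInLpOn (Set.Ico 0 1) 3 (u k) ∧ u k 0 = U k ∧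
      MeasureTheory.AEStronglyMeasurable (Function.uncurry (u k)) (MeasureTheory.volume.restrict (Set.Ioo (0 : ℝ) 1 ×ˢ (Set.univ : Set (EuclideanSpace ℝ (Fin 3)))))) →
      (∀ r : ℝ, 0 < r → Filter.Tendsto (fun k => MeasureTheory.eLpNorm (Function.uncurry (u k)) ⊤ (MeasureTheory.volume.restrict (Literature.Analysis.FluidPDE.parabolicCylinder r ((1 : ℝ), x k)))) Filter.atTop (nhds ⊤)) →
      ∀ ρ' : ℝ≥0∞, ρ' < Literature.Analysis.FluidPDE.rusinSverakRhoMaxPure ν → ∃ᶠ k in Filter.atTop, ρ' < ‖G k‖ₑ := by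
  intro ν hν U G u x hU hkato hconc ρ' hρ'
  by_contra hnot
  rw [Filter.not_frequently] at hnot
  obtain ⟨K, hK⟩ := Filter.eventually_atTop.1 hnot
  -- the tail from `K` on is a uniformly sub-threshold concentrating sequence: impossible
  refine no_concentration_uniformly_below_threshold ν hν (fun k => U (k + K)) (fun k => G (k + K))
    (fun k => u (k + K)) (fun k => x (k + K)) (fun k => hU (k + K))
    ⟨ρ', hρ', fun k => not_lt.1 (hK (k + K) (Nat.le_add_left K k))⟩ (fun k => hkato (k + K)) ?_
  intro r hr
  exact (hconc r hr).comp (tendsto_add_atTop_nat K)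

end Summit.NavierStokesRegularity.NavierStokesRegularity.Theorems.MinimalDatumPFold.Negative

end
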